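import Literature.MathematicalPhysics.QuantumFieldTheory.Balaban1983to89.Node00.MultiScaleFibreChartLagrange
import Literature.MathematicalPhysics.QuantumFieldTheory.Balaban1983to89.B16Ineq19NearFlatSliceNorms
import Literature.MathematicalPhysics.QuantumFieldTheory.Balaban1983to89.MatrixNorms

/-!
# NODE 00 — THE MULTIPLIER LETTER (μ) OF THE NEAR-FLAT ONE-SIDED (1.7) SKELETON AT THE CANONICAL CHART OF THE MULTI-SCALE CONSTRAINT, AT THE LINEAGE's EXISTENCE LEVEL:
# `λ₀(D²Ψ(0)(w,w)) ≤ μ·p(w)²` with `μ = j·ρ·N·M₂`, `M₂` a (per-torus) bound of the chart's curvature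

[Balaban1989LargeFieldII] = «[LF-II]», (1.12) p. 359 (the multiplier absorbed into the error of (1.7)), p. 357; [Balaban1985Variational] = «[15]», Sect. C (44)–(48) p. 285 (the
linearised averaging and its right inverses), (82)–(83) p. 290, (170)–(171) p. 305; [Balaban1985Averaging], (17)–(19) p. 21 (the two norms on `M_N(ℂ)`).

Cell `pub-ymgap`, HUMAN RULING D-0062 ∕ D-0149, width seat `pub-ymgap-dag-n12-w4` generation 3 (WIDTH SEAT 4 of 4 on N12 = [B15]; lane U2c; INBOX CLAIM-3 ∕ INTENT-3 of 2026-08-28).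
`--kind proof --supports stmt-QuantumFields-20542` (K1⁷; count-neutral helper).  NEW leaf; CONSUMED BY NAME, nothing modified: this seat's `Node00.MultiScaleFibreChartLagrange` (p610492:
`exists_lam_msChart_bound_of_rightInverse_fun`, `isCritOnFibre_of_isMinimizer_regMSCoPOfRecord`), n07-w2's `Node00.MultiScaleFibreChart` (`msChart`), dag-n12-w2's
`B16Ineq19NearFlatSliceNorms` (sequel direction of its `opNorm_coe_le_norm_lieSU`), `Node00.WilsonActionSecondVariationNearFlat.norm_sq_lieSU_eq_re_trace`, the cell's `MatrixNorms`
(`sum_norm_sq_col_le_opNorm_sq`, `sum_norm_sq_eq_re_trace`), r12's `B14.Eq213DetSet` (`Bj`, `Bj_of_gt`).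

WHY.  In the lane owner's assembled endpoint (`B15Prop1EndpointNearFlatLetters`, dag-n12-c p610003; junction `B15Prop1SliceHessianOfChartFamily` §4) the package (N) binds, at the chart of record
`Ψ := msChart F N K k 𝐁 W U₀`, the multiplier `lam` with `hlam` and, per slice vector `X`, the letter (μ) `hμ : lam (Ψ₂ (X_f′X) (X_f′X)) ≤ μ·p(X_f′X)²`.  This seat's g2 reduced (μ) to
`μ = j·ρ·M₂` (`B16Ineq17NearFlatOneSided.multiplier_letter_of_current`: current bound `j`, right-inverse size `ρ`, chart curvature `‖Ψ₂(w,w)‖ ≤ M₂·p(w)²`) and p610492 produced `lam` with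
`|λ₀ v| ≤ j·ρ·‖v‖`.  THIS MODULE supplies the last factor AT THE LINEAGE's PRESENT HONESTY LEVEL: `M₂` EXISTS for every torus of the family (a continuous bilinear form on a finite-dimensional
space is bounded — §2–§3), and §4 assembles `lam`, `hlam`, `hμ` from ONE call.

LOCATED, STATED UP FRONT: `M₂` here (hence `μ∕j`) is a PER-TORUS existence constant — exactly the level of dag-n10-w1's radius `ρ′` («EXISTS by smoothness constants; print's O(L²α₀) NOT
claimed», p605814).  Print's VOLUME-UNIFORM `O(1)` bound on the curvature of the averaging chart (locality of `Ū^j` + [15] Sect. C (48) ∕ Sect. G second-order bounds) is NOT claimed; it is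
THE one remaining uniform estimate of the (μ) row, to be typed as `‖(D²Ψ(0)(w,w))_{(j,c)}‖ ≤ C(d,L,N)·sup_{b near B^j(c)}‖w_b‖²` by the averaging-chart lane.

CONTENTS (namespace `…Balaban1983to89.Node00`; theorems only — no `def`, no `instance`, no `notation`, no `sorry`).
* §1 `norm_sq_le_card_mul_opNorm_coe_sq` ∕ ★ `norm_le_sqrt_card_mul_opNorm_coe` (`‖Z‖_HS ≤ √N·‖↑Z‖_op` on `𝔰𝔲(N)`), ★ `pi_norm_le_sqrt_card_mul_seminorm` (`‖Y‖ ≤ √N·p(Y)` for the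
  junction's `p` with `hp : Σ_b‖↑Y_b‖²_op ≤ p(Y)²`).
* §2 `exists_sq_bound_of_bilinear` (generic: `∃ C ≥ 0, ∀ w, ‖B w w‖ ≤ C‖w‖²`).
* §3 ★ `exists_chartCurvature_sq_bound` (`∃ M₂ ≥ 0, ∀ w, ‖D²Ψ(0)(w,w)‖ ≤ M₂‖w‖²` at `Ψ := msChart …`), `exists_chartCurvature_sq_bound_seminorm` (`≤ N·M₂·p(w)²`).
* §3½ `msChart_congr_of_agreeOn` ∕ `msChart_eq_msChart_avgFamily_of_agreeOn` (the chart depends on the datum only through `𝐁`: J-C's datum `M˙(Q_k^{s*}Ṽ)` vs dag-n10-w1's self-datum `M˙(U₀)`).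
* §4 ★★★ `exists_lam_mu_msChart_of_rightInverse_fun` (J-C's `lam`, `hlam` and (μ) from the fibre condition, the guard, a right inverse of `DΨ(0)` as a function with `p(Rv) ≤ ρ‖v‖`, the
  current bound `|D(A∘expChart U₀)(0)x| ≤ j·p(x)` and curve-criticality), ★★ `exists_lam_mu_msChart_Bj_of_isMinimizer_regMSCoPOfRecord` (record edition: `hcrit` by minimality over NODE 00's
  class, `𝐁 = Bj M₁ Z k`).

HONEST FRAMING: finite-dimensional calculus and norm bookkeeping; per-torus constants as located above; nothing of Bałaban's asserted; N12 NOT discharged; K1⁷ NOT closed; counts unmoved (5∕27);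
one finite 𝕋⁴ programme at fixed ε — R4 closes the conditional finite-𝕋⁴ rung `BalabanLadder.UV` only; NOT continuum ∕ ℝ⁴ ∕ OS ∕ mass gap ∕ Clay.
-/

noncomputable section

namespace Literature.MathematicalPhysics.QuantumFieldTheory.Balaban1983to89.Node00

open Filter Topology
open T4Continuum (T4Family)
open B15DeterminingSets
open T4AdjointCovarianceUnitary (lieSU)
open B14.Eq213DetSet (Bj Bj_of_gt)
open scoped Matrix.Norms.L2Operator BigOperators

/-! ## §1  Norm bookkeeping: Hilbert–Schmidt ≤ √N · operator on `𝔰𝔲(N)`; the sup norm of a bond field against the junction's seminorm -/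

section Norms

variable {N : ℕ}

/-- `‖Z‖²_HS ≤ N·‖↑Z‖²_op` for `Z ∈ 𝔰𝔲(N)`: `‖Z‖²_HS = Σ_ij |Z_ij|²` (`norm_sq_lieSU_eq_re_trace`, `MatrixNorms.sum_norm_sq_eq_re_trace`) and each column has `Σ_i |Z_ij|² ≤ ‖↑Z‖²_op`
(`MatrixNorms.sum_norm_sq_col_le_opNorm_sq`). [cite: Balaban1985Averaging, (17)–(19) p.21] -/
theorem norm_sq_le_card_mul_opNorm_coe_sq (Z : lieSU (Fin N)) : ‖Z‖ ^ 2 ≤ N * ‖(Z : Matrix (Fin N) (Fin N) ℂ)‖ ^ 2 := by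
  rw [norm_sq_lieSU_eq_re_trace, Matrix.star_eq_conjTranspose, ← MatrixNorms.sum_norm_sq_eq_re_trace]
  rw [Finset.sum_comm]
  calc ∑ j : Fin N, ∑ i : Fin N, ‖(Z : Matrix (Fin N) (Fin N) ℂ) i j‖ ^ 2 ≤ ∑ _j : Fin N, ‖(Z : Matrix (Fin N) (Fin N) ℂ)‖ ^ 2 :=
        Finset.sum_le_sum fun j _ => MatrixNorms.sum_norm_sq_col_le_opNorm_sq _ j
    _ = N * ‖(Z : Matrix (Fin N) (Fin N) ℂ)‖ ^ 2 := by rw [Finset.sum_const, Finset.card_univ, Fintype.card_fin, nsmul_eq_mul]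

/-- ★ `‖Z‖_HS ≤ √N·‖↑Z‖_op` for `Z ∈ 𝔰𝔲(N)` (the converse direction to dag-n12-w2's `opNorm_coe_le_norm_lieSU`). [cite: Balaban1985Averaging, (17)–(19) p.21] -/
theorem norm_le_sqrt_card_mul_opNorm_coe (Z : lieSU (Fin N)) : ‖Z‖ ≤ Real.sqrt N * ‖(Z : Matrix (Fin N) (Fin N) ℂ)‖ := by
  have h := norm_sq_le_card_mul_opNorm_coe_sq Z
  have hN : (0 : ℝ) ≤ N := Nat.cast_nonneg _
  calc ‖Z‖ = Real.sqrt (‖Z‖ ^ 2) := (Real.sqrt_sq (norm_nonneg _)).symm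
    _ ≤ Real.sqrt (N * ‖(Z : Matrix (Fin N) (Fin N) ℂ)‖ ^ 2) := Real.sqrt_le_sqrt h
    _ = Real.sqrt N * ‖(Z : Matrix (Fin N) (Fin N) ℂ)‖ := by rw [Real.sqrt_mul hN, Real.sqrt_sq (norm_nonneg _)]

/-- ★ **THE SUP NORM OF A BOND FIELD AGAINST THE JUNCTION's SEMINORM**: if `Σ_b ‖↑Y_b‖²_op ≤ p(Y)²` (the binder `hp` of `B15Prop1SliceHessianOfChartFamily` §4; at the record `p` = the `ℓ²`
of operator norms, dag-n12-c's word (ii)), then `‖Y‖ ≤ √N·p(Y)` (`‖Y‖` = the sup over bonds of the Hilbert–Schmidt norms). [cite: Balaban1985Averaging, (17)–(19) p.21; Balaban1989LargeFieldII, (1.7) p.358] -/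
theorem pi_norm_le_sqrt_card_mul_seminorm {ι : Type*} [Fintype ι] (p : Seminorm ℝ (ι → lieSU (Fin N)))
    (hp : ∀ Y : ι → lieSU (Fin N), ∑ b, ‖(Y b : Matrix (Fin N) (Fin N) ℂ)‖ ^ 2 ≤ p Y ^ 2) (Y : ι → lieSU (Fin N)) :
    ‖Y‖ ≤ Real.sqrt N * p Y := by
  have hp0 : 0 ≤ p Y := apply_nonneg p Y
  refine (pi_norm_le_iff_of_nonneg (by positivity)).2 fun b => ?_
  have hb : ‖(Y b : Matrix (Fin N) (Fin N) ℂ)‖ ^ 2 ≤ p Y ^ 2 :=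
    (Finset.single_le_sum (fun b _ => sq_nonneg ‖(Y b : Matrix (Fin N) (Fin N) ℂ)‖) (Finset.mem_univ b)).trans (hp Y)
  have hb' : ‖(Y b : Matrix (Fin N) (Fin N) ℂ)‖ ≤ p Y := by
    calc ‖(Y b : Matrix (Fin N) (Fin N) ℂ)‖ = Real.sqrt (‖(Y b : Matrix (Fin N) (Fin N) ℂ)‖ ^ 2) := (Real.sqrt_sq (norm_nonneg _)).symm
      _ ≤ Real.sqrt (p Y ^ 2) := Real.sqrt_le_sqrt hb
      _ = p Y := Real.sqrt_sq hp0
  calc ‖Y b‖ ≤ Real.sqrt N * ‖(Y b : Matrix (Fin N) (Fin N) ℂ)‖ := norm_le_sqrt_card_mul_opNorm_coe _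
    _ ≤ Real.sqrt N * p Y := mul_le_mul_of_nonneg_left hb' (Real.sqrt_nonneg _)

end Norms

/-! ## §2  A continuous bilinear form is bounded on the diagonal -/

section Bilinear

variable {E V : Type*} [NormedAddCommGroup E] [NormedSpace ℝ E] [NormedAddCommGroup V] [NormedSpace ℝ V]

/-- `‖B w w‖ ≤ ‖B‖·‖w‖²` — a continuous bilinear map is bounded on the diagonal (generic; the constant is the operator norm of `B`). [cite: Balaban1985Variational, (81) p.290 (bookkeeping: second-order terms)] -/
theorem exists_sq_bound_of_bilinear (B : E →L[ℝ] E →L[ℝ] V) : ∃ C : ℝ, 0 ≤ C ∧ ∀ w, ‖B w w‖ ≤ C * ‖w‖ ^ 2 :=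
  ⟨‖B‖, B.opNorm_nonneg, fun w => (B.le_opNorm₂ w w).trans (le_of_eq (by ring))⟩

end Bilinear

/-! ## §3  The curvature of the chart of record is bounded (per torus) -/

section Curvature

variable {F : T4Family} {N : ℕ} [NeZero N]
variable {K k : ℕ} {𝔹 : DetSet (F.P K)} {W : MSField (F.P K) (SU N)} {U : GaugeField (F.P K) 0 (SU N)}

/-- ★ **THE CURVATURE OF THE CHART OF RECORD IS BOUNDED (PER TORUS)**: `∃ M₂ ≥ 0, ∀ w, ‖D²Ψ(0)(w,w)‖ ≤ M₂·‖w‖²` for `Ψ := msChart F N K k 𝐁 W U₀` — the bilinear bound of §2 at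
`D²Ψ(0) := fderiv ℝ (fderiv ℝ Ψ) 0` (the `Ψ₂` of `hasFDerivAt_fderiv_msChart`).  LOCATED: `M₂` depends on the torus (finite-dimensionality), NOT print's volume-uniform `O(1)`.
[cite: Balaban1985Variational, Sect. C (44)–(48) p.285, (81)–(83) p.290; Balaban1989LargeFieldII, (1.12) p.359] -/
theorem exists_chartCurvature_sq_bound :
    ∃ M₂ : ℝ, 0 ≤ M₂ ∧ ∀ w : PBond (F.P K) 0 → lieSU (Fin N),
      ‖fderiv ℝ (fderiv ℝ (msChart F N K k 𝔹 W U)) 0 w w‖ ≤ M₂ * ‖w‖ ^ 2 :=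
  exists_sq_bound_of_bilinear (fderiv ℝ (fderiv ℝ (msChart F N K k 𝔹 W U)) 0)

/-- The same against the junction's seminorm: `‖D²Ψ(0)(w,w)‖ ≤ N·M₂·p(w)²` when `Σ_b ‖↑w_b‖²_op ≤ p(w)²`. [cite: Balaban1989LargeFieldII, (1.12) p.359; Balaban1985Averaging, (17)–(19) p.21] -/
theorem exists_chartCurvature_sq_bound_seminorm (p : Seminorm ℝ (PBond (F.P K) 0 → lieSU (Fin N)))
    (hp : ∀ Y : PBond (F.P K) 0 → lieSU (Fin N), ∑ b, ‖(Y b : Matrix (Fin N) (Fin N) ℂ)‖ ^ 2 ≤ p Y ^ 2) :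
    ∃ M₂ : ℝ, 0 ≤ M₂ ∧ ∀ w : PBond (F.P K) 0 → lieSU (Fin N),
      ‖fderiv ℝ (fderiv ℝ (msChart F N K k 𝔹 W U)) 0 w w‖ ≤ N * M₂ * p w ^ 2 := by
  obtain ⟨M₂, hM₂, hB⟩ := exists_chartCurvature_sq_bound (F := F) (N := N) (K := K) (k := k) (𝔹 := 𝔹) (W := W) (U := U)
  refine ⟨M₂, hM₂, fun w => (hB w).trans ?_⟩
  have hw := pi_norm_le_sqrt_card_mul_seminorm p hp w
  have hN : (0 : ℝ) ≤ N := Nat.cast_nonneg _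
  have hsq : ‖w‖ ^ 2 ≤ N * p w ^ 2 := by
    have h0 : 0 ≤ ‖w‖ := norm_nonneg _
    calc ‖w‖ ^ 2 ≤ (Real.sqrt N * p w) ^ 2 := pow_le_pow_left₀ h0 hw 2
      _ = N * p w ^ 2 := by rw [mul_pow, Real.sq_sqrt hN]
  calc M₂ * ‖w‖ ^ 2 ≤ M₂ * (N * p w ^ 2) := mul_le_mul_of_nonneg_left hsq hM₂
    _ = N * M₂ * p w ^ 2 := by ring

end Curvature

/-! ## §3½  The chart depends on the datum only through the constrained bonds -/

section Datum

variable {F : T4Family} {N : ℕ} [NeZero N]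
variable {K k : ℕ} {𝔹 : DetSet (F.P K)} {W W' : MSField (F.P K) (SU N)} {U : GaugeField (F.P K) 0 (SU N)}

/-- **THE CHART DEPENDS ON THE DATUM ONLY THROUGH THE CONSTRAINED BONDS**: data agreeing on `𝐁` give the SAME chart `msChart … W U = msChart … W′ U` (as functions) — the dictionary
between the lane owner's datum `M˙(Q_k^{s*}Ṽ)` (J-C) and dag-n10-w1's self-datum `M˙(U₀)` ((δ₂)∕`hsurj` modules D∕F∕G), which agree on `𝐁` by the fibre condition.
[cite: Balaban1988Convergent, (2.10)–(2.12) p.256 (bookkeeping)] -/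
theorem msChart_congr_of_agreeOn (h : ∀ j, ∀ c ∈ bondsOf (𝔹 j), W j c = W' j c) :
    msChart F N K k 𝔹 W U = msChart F N K k 𝔹 W' U := by
  funext X i
  rw [msChart_apply, msChart_apply, relAvg, relAvg, h _ _ ((constrEnum 𝔹 k).symm i).2.2]

/-- In particular, for `U₀` IN THE FIBRE of `W` the chart against `W` is the chart against `U₀`'s own averages `M˙(U₀)` (dag-n10-w1's form).
[cite: Balaban1988Convergent, (2.10)–(2.12) p.256 (bookkeeping)] -/
theorem msChart_eq_msChart_avgFamily_of_agreeOn (hU : AgreeOn 𝔹 (avgFamily (avOfRecord F N K) U) W) :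
    msChart F N K k 𝔹 W U = msChart F N K k 𝔹 (avgFamily (avOfRecord F N K) U) U :=
  msChart_congr_of_agreeOn fun j c hc => (hU j c hc).symm

end Datum

/-! ## §4  The multiplier letter (μ) assembled: `lam`, `hlam`, `hμ` from one call -/

section Multiplier

variable {F : T4Family} {N : ℕ} [NeZero N]
variable {K k : ℕ} {𝔹 : DetSet (F.P K)} {W : MSField (F.P K) (SU N)} {U : GaugeField (F.P K) 0 (SU N)}

/-- ★★★ **THE MULTIPLIER AND ITS LETTER (μ) AT THE CHART OF RECORD, FROM ONE CALL** (J-C's binders `lam`, `hlam`, and per-`X` `hμ` at `w := X_f′X`, with `Ψ₂ := D²Ψ(0)`): for `𝐁` with no member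
above `k`, `U₀` in the fibre with guarded averages, the junction's seminorm `p` (`Σ_b‖↑Y_b‖²_op ≤ p(Y)²`), a right inverse `R` of `DΨ(0)` as a function with `p(Rv) ≤ ρ·‖v‖` (letters
(ρ♭)+(δ₂) combined; dag-n10-w1's function-currency right inverses), the CURRENT bound `|D(A∘expChart U₀)(0)x| ≤ j·p(x)` and curve-criticality of `U₀` on the fibre: there are `lam` and
`μ ≥ 0` with `D(A∘expChart U₀)(0) = lam ∘ DΨ(0)` and `lam(D²Ψ(0)(w,w)) ≤ μ·p(w)²` for every `w` — `μ := j·ρ·N·M₂` with §3's per-torus curvature bound `M₂` (LOCATED: not print's uniform `O(1)`).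
[cite: Balaban1989LargeFieldII, (1.12) p.359, p.357; Balaban1985Variational, (82)–(83) p.290, (170)–(171) p.305, Sect. C (44)–(48) p.285] -/
theorem exists_lam_mu_msChart_of_rightInverse_fun (h𝔹 : ∀ j, k < j → 𝔹 j = ∅)
    (hU : AgreeOn 𝔹 (avgFamily (avOfRecord F N K) U) W) (hsb : SmallBelow (avOfRecord F N K) k U)
    (p : Seminorm ℝ (PBond (F.P K) 0 → lieSU (Fin N)))
    (hp : ∀ Y : PBond (F.P K) 0 → lieSU (Fin N), ∑ b, ‖(Y b : Matrix (Fin N) (Fin N) ℂ)‖ ^ 2 ≤ p Y ^ 2)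
    {R : (Fin (constrCard 𝔹 k) → lieSU (Fin N)) → PBond (F.P K) 0 → lieSU (Fin N)} (hR : ∀ v, fderiv ℝ (msChart F N K k 𝔹 W U) 0 (R v) = v)
    {j ρ : ℝ} (hj0 : 0 ≤ j) (hρ0 : 0 ≤ ρ)
    (hj : ∀ x, |fderiv ℝ (fun Y : PBond (F.P K) 0 → lieSU (Fin N) => wilsonAction4 (expChart U Y)) 0 x| ≤ j * p x)
    (hρ : ∀ v, p (R v) ≤ ρ * ‖v‖) (hcrit : IsCritOnFibre F N K 𝔹 W U) :
    ∃ lam : (Fin (constrCard 𝔹 k) → lieSU (Fin N)) →L[ℝ] ℝ, ∃ μ : ℝ, 0 ≤ μ ∧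
      fderiv ℝ (fun Y : PBond (F.P K) 0 → lieSU (Fin N) => wilsonAction4 (expChart U Y)) 0 = lam.comp (fderiv ℝ (msChart F N K k 𝔹 W U) 0) ∧
        ∀ w : PBond (F.P K) 0 → lieSU (Fin N), lam (fderiv ℝ (fderiv ℝ (msChart F N K k 𝔹 W U)) 0 w w) ≤ μ * p w ^ 2 := by
  obtain ⟨lam, hlam, hbd⟩ := exists_lam_msChart_bound_of_rightInverse_fun h𝔹 hU hsb p (fun v => ‖v‖) hR hj0 hj hρ hcrit
  obtain ⟨M₂, hM₂, hcurv⟩ := exists_chartCurvature_sq_bound_seminorm (F := F) (N := N) (K := K) (k := k) (𝔹 := 𝔹) (W := W) (U := U) p hp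
  refine ⟨lam, j * ρ * (N * M₂), by positivity, hlam, fun w => ?_⟩
  calc lam (fderiv ℝ (fderiv ℝ (msChart F N K k 𝔹 W U)) 0 w w)
        ≤ |lam (fderiv ℝ (fderiv ℝ (msChart F N K k 𝔹 W U)) 0 w w)| := le_abs_self _
    _ ≤ j * ρ * ‖fderiv ℝ (fderiv ℝ (msChart F N K k 𝔹 W U)) 0 w w‖ := hbd _
    _ ≤ j * ρ * (N * M₂ * p w ^ 2) := mul_le_mul_of_nonneg_left (hcurv w) (by positivity)
    _ = j * ρ * (N * M₂) * p w ^ 2 := by ring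

/-- ★★ **THE SAME AT THE N12∕s1 ENDPOINT's OBJECTS** — class of record `regMSCoPOfRecord F N ν K k′ Ω`, determining set `𝐁_k(Z) = Bj M₁ Z k`, `U₀` a (2.12) minimiser there (the `Y = 0` member of the
(K′) family): `hcrit` is discharged by minimality (`isCritOnFibre_of_isMinimizer_regMSCoPOfRecord`), `h𝐁` by `Bj_of_gt`, the fibre condition is part of `IsMinimizer`.
[cite: Balaban1989LargeFieldII, (1.12) p.359; Balaban1985Variational, (82)–(83) p.290, p.299–300; Balaban1988Convergent, (2.12)–(2.13) pp.256–257] -/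
theorem exists_lam_mu_msChart_Bj_of_isMinimizer_regMSCoPOfRecord (ν : Stage7Numerics) {k' : ℕ} (Ω : ℕ → Set (Site (F.P K) 0)) (M₁ : ℕ)
    (Z : Set (Site (F.P K) 0)) {W : MSField (F.P K) (SU N)} {U₀ : GaugeField (F.P K) 0 (SU N)}
    (h : IsMinimizer (avOfRecord F N K) (regMSCoPOfRecord F N ν K k' Ω) (Bj M₁ Z k) W U₀) (hsb : SmallBelow (avOfRecord F N K) k U₀)
    (p : Seminorm ℝ (PBond (F.P K) 0 → lieSU (Fin N)))
    (hp : ∀ Y : PBond (F.P K) 0 → lieSU (Fin N), ∑ b, ‖(Y b : Matrix (Fin N) (Fin N) ℂ)‖ ^ 2 ≤ p Y ^ 2)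
    {R : (Fin (constrCard (Bj M₁ Z k) k) → lieSU (Fin N)) → PBond (F.P K) 0 → lieSU (Fin N)}
    (hR : ∀ v, fderiv ℝ (msChart F N K k (Bj M₁ Z k) W U₀) 0 (R v) = v)
    {j ρ : ℝ} (hj0 : 0 ≤ j) (hρ0 : 0 ≤ ρ)
    (hj : ∀ x, |fderiv ℝ (fun Y : PBond (F.P K) 0 → lieSU (Fin N) => wilsonAction4 (expChart U₀ Y)) 0 x| ≤ j * p x)
    (hρ : ∀ v, p (R v) ≤ ρ * ‖v‖) :
    ∃ lam : (Fin (constrCard (Bj M₁ Z k) k) → lieSU (Fin N)) →L[ℝ] ℝ, ∃ μ : ℝ, 0 ≤ μ ∧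
      fderiv ℝ (fun Y : PBond (F.P K) 0 → lieSU (Fin N) => wilsonAction4 (expChart U₀ Y)) 0 = lam.comp (fderiv ℝ (msChart F N K k (Bj M₁ Z k) W U₀) 0) ∧
        ∀ w : PBond (F.P K) 0 → lieSU (Fin N), lam (fderiv ℝ (fderiv ℝ (msChart F N K k (Bj M₁ Z k) W U₀)) 0 w w) ≤ μ * p w ^ 2 :=
  exists_lam_mu_msChart_of_rightInverse_fun (fun _ hj' => Bj_of_gt hj') h.2.1 hsb p hp hR hj0 hρ0 hj hρ
    (isCritOnFibre_of_isMinimizer_regMSCoPOfRecord ν Ω h)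

end Multiplier

end Literature.MathematicalPhysics.QuantumFieldTheory.Balaban1983to89.Node00

end
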